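import Mathlib
import HarnessLib
import HarnessLib.Audit
import Summits.AtomisticToContinuum.Statement
import Literature.MathematicalPhysics.KineticTheory.LangevinChainKernel
import Literature.MathematicalPhysics.KineticTheory.LangevinChainGibbs
import Literature.MathematicalPhysics.KineticTheory.LangevinChainNESS

/-!
Route: DynamicalGriffiths

CLOSED (retired) 2026-08-15T13:41:50Z by operator:999:1257524 — reason: not-a-thesis: assembly does not conclude the sub-problem Statement — note: D-0027 §2.1 audit (human 2026-08-15: routes that do not decide the summit are removed): the assembly concludes `NessMaxPrinciple`, not the sub-problem statement; a NEW conforming route may be opened from the same idea (generated `closes : … → _root_.FouriersLaw`).. The file is kept as the record of this route; refuted decls are indexed as negative knowledge (`ledger negatives`).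

# Route DynamicalGriffiths — dynamical Griffiths inequality for kinetic energies gives the
linear-response comparison principle (rung route)

RUNG ROUTE realising idea card dynamical-energy-positivity-dep (into which
energetic-attractiveness-max-principle and thermal-attractiveness-propagator-positivity were
merged): a SIGN LEVER, not a proof of the conjunct — the dynamical inequality holds for the
ballistic harmonic chain, so NO assembly to FouriersLaw is claimed (cf. route
SingleThermostatRigidity for the rung format). Notation: P = pinnedChain ω₂ lam β γ (all four > 0),
N-site chain with BOTH Langevin baths at T > 0 (equilibrium dynamics; Gibbs state μ_T =
P.gibbsMeasure N T, proved stationary; P_u = the CONSTRUCTED transition kernels P.transitionKernel N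
T T u of LangevinChainKernel.lean), and for sites x, y the kinetic-energy response kernel K_N(x,y,u)
:= ∫ (p_x² − T)·P_u(p_y² − T) dμ_T (= Cov_T(p_x²(0), p_y²(u)) once Gibbs invariance of the kernels
is in hand): the mean excess kinetic energy at y a time u after kinetic energy was injected at x.
X_DG (LINEAR-RESPONSE COMPARISON / MAXIMUM PRINCIPLE for the two-bath chain): under weak-NESS
uniqueness, for every steady-state family μ_{N,T_L,T_R}, every T > 0, N and site y, heating ONE bath
by δ changes ⟨p_y²⟩ by d·δ + o(δ) with 0 ≤ d ≤ 1, for each of the two baths — to first order in the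
driving every local kinetic temperature stays between the bath temperatures. This is the two-bath,
first-order form of the comparison statement Bonetto–Lebowitz–Lukkarinen–Olla record as beyond reach
even for THREE oscillators (BonettoLebowitzLukkarinenOlla2009 §9: "We certainly expect that T_R < T
< T_L, but do not know how to prove this"; p. 6: "We expect, but are not able to prove, that the
self-consistent profiles remain uniformly bounded"), known only for harmonic networks
(BonettoLebowitzLukkarinen2004, RiederLebowitzLieb1967).
It suffices to show (Assembly; glue PROVED by the planner, AssemblyCheck.lean rc 0, axioms
propext/Classical.choice/Quot.sound): (A) DEPKinIntegrated — the time-integrated DYNAMICAL GRIFFITHS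
INEQUALITY ∫_0^∞ K_N(x,y,u) du ≥ 0 for all x, y, N (its pointwise parent DEPKin, K_N(x,y,u) ≥ 0 for
every u ≥ 0 — "kinetic energy injected anywhere is, on average, never missing anywhere later" — is
the card's conjecture DEP_kin and the rank-2 crux); (B) DirectionalResponse — the Kundu–Dhar–Narayan
noise-amplitude identity at fixed N: the derivative of ⟨p_y²⟩ along (T_L,T_R) = (T+aδ, T+bδ) exists
and equals a·(γ/T²)∫_0^∞K_N(0,y) + b·(γ/T²)∫_0^∞K_N(N−1,y); (C) GibbsKineticTemperature —
equipartition ∫p_y² dμ_T = T (provable now). Then d_L = (γ/T²)∫K_N(0,y) ≥ 0 and d_R ≥ 0 by (A), and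
d_L + d_R = 1 because shifting both baths moves the Gibbs state (uniqueness +
pinnedChain_isSteadyState_gibbsMeasure, proved): a discrete maximum principle whose boundary is the
pair of baths. The covariance-level form 0 ≤ (γ/T²)∫_0^∞K_N(b,y) ≤ 1 (KernelMaxPrinciple; b a bath
site) follows WITHOUT any response theory from (A) + KernelSymmetry + ExitSumRule (glue
KernelMaxPrincipleGlue, also planner-proved) and is the sign input that routes EscapeDeficit (engine
"maximum principle 0 ≤ θ ≤ 1" of HalfChainTailLaw; the SIGNS child of DiffusiveCrossover =
BoundaryThermalisationMonotone here), ContactEchoWindows (transmission η̄_N ∈ [0,1]),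
TwoChannelDephasing (sign of the end-to-end kernel) and FeketeResistance/SuperadditiveJunction
(M-matrix sign of reservoir networks) currently assume or foresee.
Lean: `∀ ω₂ lam β γ : ℝ, 0 < ω₂ → 0 < lam → 0 < β → 0 < γ → (∀ (N : ℕ) (T_L T_R : ℝ), 0 < T_L → 0 <
T_R → ∀ μ ν : MeasureTheory.Measure
(Literature.MathematicalPhysics.KineticTheory.HeatConduction.PhaseSpace N),
(Literature.MathematicalPhysics.KineticTheory.HeatConduction.pinnedChain ω₂ lam β γ).IsSteadyState N
T_L T_R μ → (Literature.MathematicalPhysics.KineticTheory.HeatConduction.pinnedChain ω₂ lam β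
γ).IsSteadyState N T_L T_R ν → μ = ν) → ∀ μ : (N : ℕ) → ℝ → ℝ → MeasureTheory.Measure
(Literature.MathematicalPhysics.KineticTheory.HeatConduction.PhaseSpace N), (∀ (N : ℕ) (T_L T_R :
ℝ), 0 < T_L → 0 < T_R → (Literature.MathematicalPhysics.KineticTheory.HeatConduction.pinnedChain ω₂
lam β γ).IsSteadyState N T_L T_R (μ N T_L T_R)) → ∀ T : ℝ, 0 < T → ∀ (N : ℕ) (y : Fin N), (∃ d : ℝ,
0 ≤ d ∧ d ≤ 1 ∧ Filter.Tendsto (fun δ : ℝ => ((∫ z, (z.2 y) ^ 2 ∂(μ N (T + δ) T)) - ∫ z, (z.2 y) ^ 2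
∂(μ N T T)) / δ) (nhdsWithin 0 {(0 : ℝ)}ᶜ) (nhds d)) ∧ (∃ d : ℝ, 0 ≤ d ∧ d ≤ 1 ∧ Filter.Tendsto (fun
δ : ℝ => ((∫ z, (z.2 y) ^ 2 ∂(μ N T (T + δ))) - ∫ z, (z.2 y) ^ 2 ∂(μ N T T)) / δ) (nhdsWithin 0 {(0
: ℝ)}ᶜ) (nhds d))`

## Assembly
Glue (real analysis, ~50 lines; PROVED by the planner as `theorem assembly_holds : Assembly` in
AssemblyCheck.lean, rc 0, axioms propext/Classical.choice/Quot.sound): fix parameters, the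
uniqueness hypothesis, a steady family μ, T > 0, N (N = 0: Fin 0 is empty), y. DirectionalResponse
with (a,b) = (1,0), (0,1), (1,1) gives the three limits d_L = c_L, d_R = c_R, c_L + c_R with c_L =
(γ/T²)∫K_N(0,y), c_R = (γ/T²)∫K_N(N−1,y) (simp one_mul/zero_mul/add_zero to match μ N (T+δ) T);
DEPKinIntegrated gives c_L, c_R ≥ 0; for 0 < |δ| < T, μ N (T+δ) (T+δ) = gibbsMeasure N (T+δ) by the
uniqueness hypothesis and pinnedChain_isSteadyState_gibbsMeasure (proved), so by
GibbsKineticTemperature the (1,1) difference quotient is identically ((T+δ) − T)/δ = 1 near 0, hence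
c_L + c_R = 1 (tendsto_nhds_unique on 𝓝[≠] 0) and c_L, c_R ≤ 1. The target is the route's own decl
NessMaxPrinciple (rung route: no arrow to the conjunct is claimed; FouriersLaw needs the
N-dependence of D_N, which no sign statement carries).

Rationale: WHY THIS LINE. Mechanism: POSITIVITY ⇒ COMPARISON. A sign for the even–even (energy–energy) sector
of the equilibrium dynamics turns the two baths into the boundary of a maximum principle and the
bath-to-site response into a sub-stochastic kernel (KunduDharNarayan2009 gives the exact dictionary
∂_{T_b}⟨F⟩ = (γ/T²)∫_0^∞⟨(p_b²−T)(0)F(t)⟩dt; BonettoLebowitzReyBellet2000 §5.2 the energy balance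
behind ExitSumRule). The sign is a THEOREM at the three scales where the chain is understood —
harmonic member (Isserlis: K = 2Cov(p_x,p_y(u))² ≥ 0, coexisting with ballistic transport;
HarmonicDEP, provable now from the tree's Gaussian machinery), kinetic limit (the linearised phonon
Boltzmann evolution is positivity preserving, AokiLukkarinenSpohn2006 §3), hydrodynamic limit (heat
kernel) — and conjectured in between; first-order perturbation at the harmonic double zeros was
checked by hand for N = 1 (quarter-period value +3·lam·T³/ω-units > 0 for HARDENING lam > 0, from
the flow term alone; the measure term vanishes). Imported areas, with their limits stated:
correlation inequalities of equilibrium statistical mechanics (GKS doi:10.1063/1.1664600, FKG for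
convex ∇φ fields doi:10.1007/s002200050102 — static only, and not even applicable statically to site
energies with the FPU-β cross term, which is why the KINETIC version is filed), positive
correlations for diffusions (Herbst–Pitt doi:10.1007/bf01312211 — needs cooperative drift, fails
pathwise for oscillators, so the sign must come from averaging, as Isserlis shows it can),
second-order Malliavin calculus and log-concave transport (doi:10.1007/s002200050012) as the
foreseen engines (Two-layer plan). What the line does that no open route does: twelve FouriersLaw
routes exist and four of them USE signs of exactly these kernels as engines or hypotheses; none
files the sign as a statement. Here it becomes a typed, cheaply refutable crux over CONSTRUCTED
objects (no new definitions), with a recognised open micro-problem (BLLO's comparison principle,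
linear-response form) as the planner-proved consequence. Negatives index: empty at filing.

RANKED CRUXES. #0 NessMaxPrinciple (target) — X_DG of § Thesis: for pinnedChain (all parameters >
0), ASSUMING uniqueness of weak steady states (hypothesis inside the statement, = NessUnique), for
every steady-state family μ, T > 0, N and y : Fin N there are d_L, d_R ∈ [0,1] with (⟨p_y²⟩_{μ N
(T+δ) T} − ⟨p_y²⟩_{μ N T T})/δ → d_L and (⟨p_y²⟩_{μ N T (T+δ)} − ⟨p_y²⟩_{μ N T T})/δ → d_R as δ → 0,
δ ≠ 0 (N = 0 vacuous; N = 1: d_L = d_R = 1/2 by the proved one-site Gibbs state). The first-order,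
two-bath form of 'local kinetic temperatures lie between the bath temperatures'. (why it might fail:
Inherits DEPKinIntegrated (a bath could, in time-integral, cool some site: resonant energy exchange
in short strongly anharmonic chains) and fixed-N response existence (DirectionalResponse); BLLO
could not prove the N = 3 self-consistent analogue.) [BonettoLebowitzLukkarinenOlla2009,
BonettoLebowitzLukkarinen2004, RiederLebowitzLieb1967, KunduDharNarayan2009]
#2 DEPKin (crux) — DYNAMICAL GRIFFITHS INEQUALITY, kinetic version, pointwise in time (card item
DEP_kin / DEP_open): for all parameters > 0, T > 0, N, sites x y and u ≥ 0: K_N(x,y,u) = ∫ (p_x² −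
T)·P_u(p_y² − T) dμ_T ≥ 0 (constructed kernels, Gibbs state, both baths at T). Static values are
harmless (K_N(x,y,0) = 2T²δ_{xy}: momenta are i.i.d. Gaussian under any Gibbs state); at lam = β = 0
it is Isserlis (HarmonicDEP); the content is u > 0, lam, β > 0, all N uniformly — the statement that
makes Zhao's 'heat-diffusion probability density' an honest sub-probability kernel and every
bath-to-site response a comparison. [difficulty: open-problem] (why it might fail: At lam=β=0 the
kernel 2Cov(p_x,p_y(u))² has double zeros (quarter periods, echo times); the O(lam,β) flow
correction decides the sign there — +3lamT³ at N=1 by hand, chains (FPU-β cross force) untested; at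
λT=O(1) and intermediate times no expansion controls it.) [doi:10.1103/physrevlett.96.140602,
doi:10.1103/physrevlett.112.040601, doi:10.1007/s002200050102, doi:10.1063/1.1664600,
RiederLebowitzLieb1967, AokiLukkarinenSpohn2006]
#3 DEPKinIntegrated (crux) — the graded weaker form actually used by the Assembly (card: DEP∫ /
DEP_kin∫; merged card energetic-attractiveness (A)): for all parameters > 0, T > 0, N, x, y: u ↦
K_N(x,y,u) is integrable on (0,∞) and ∫_0^∞ K_N(x,y,u) du ≥ 0. By KDN this is ∂⟨p_y²⟩/∂T_x ≥ 0
whenever x is a bath site ('heating a bath never cools a site', to first order); only the diagonal x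
= y is automatic (∫_0^∞⟨f,P_u f⟩ = ⟨f,(−L)⁻¹f⟩ ≥ 0 by accretivity). Follows from DEPKin +
KernelBasics; filed separately because it may survive a refutation of the pointwise sign (echo-time
negativity with positive integral). [deps: DEPKin] [difficulty: open-problem] (why it might fail:
Still a genuine off-diagonal sign claim: energy 'sloshing' between specific sites of a short,
strongly anharmonic chain (N=2,3, lam·T ≫ 1) could make one time-integral negative; no
monotone-coupling proof exists for oscillators (Herbst–Pitt needs cooperative drift).)
[KunduDharNarayan2009, BonettoLebowitzLukkarinenOlla2009, RiederLebowitzLieb1967,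
doi:10.1007/bf01312211]
#4 DirectionalResponse (crux) — KUNDU–DHAR–NARAYAN NOISE-AMPLITUDE RESPONSE at fixed N (card item
NoiseAmplitudeResponse + SumRule in one): ASSUMING weak-NESS uniqueness, for every steady-state
family μ, T > 0, N ≥ 1, site y and direction (a,b) ∈ ℝ²: K_N(0,y,·), K_N(N−1,y,·) ∈ L¹(0,∞) and
(⟨p_y²⟩_{μ N (T+aδ) (T+bδ)} − ⟨p_y²⟩_{μ N T T})/δ → a·(γ/T²)∫_0^∞K_N(0,y) + b·(γ/T²)∫_0^∞K_N(N−1,y)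
as δ → 0, δ ≠ 0. Derivation (KDN, arXiv:0809.4543 p. 3): ∂_{T_L}L = γ∂²_{p_0}, (P₀)⁻¹γ∂²_{p_0}P₀ =
γ(p_0² − T)/T², first-order perturbation of the Fokker–Planck equation from t = −∞; for N = 1 both
baths sit on site 0 and the formula gives (a+b)/2, matching the proved one-site Gibbs state at
(T_L+T_R)/2. Real content: differentiability at equilibrium of NESS expectations of p_y² in the bath
temperatures for the hypoelliptic chain (same difficulty class as items 0717 FiniteResponseOfUnique
/ 2945 ResponseIdentity / 2742 FiniteResponseProfile, different observable and both one-bath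
directions), Gibbs invariance of the constructed kernels, K ∈ L¹ from the PROVED (2.5). [difficulty:
L] (why it might fail: Fixed-N linear response at equilibrium is unproved for the Langevin pinned
chain (Hairer–Majda SDE Thm 4.4 Assumption 5 fails; verify Assumptions 1–3 via CEHR (2.5)); weak
steady states might be non-unique, making the conditional form vacuous rather than false.)
[KunduDharNarayan2009, ReyBellet2003, HairerMajda2009, BonettoLebowitzReyBellet2000,
CuneoEckmannHairerReyBellet2018, Carmona2007]
#9 KernelBasics (support) — warm-up that de-junks K (cf. EscapeDeficit.BoundaryKernelBasics, same
content for general x, y): for parameters > 0, T > 0, N ≥ 1: (a) Gibbs invariance of the constructed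
kernels, (gibbsMeasure N T).bind (transitionKernel N T T t) = gibbsMeasure N T (weak stationarity
pinnedChain_isSteadyState_gibbsMeasure is proved; invariance for the kernels needs Dynkin +
uniqueness for the forward equation, or Itô on solMap); (b) u ↦ K_N(x,y,u) continuous (Feller,
proved, + dominated convergence via (3.4)); (c) |K_N(x,y,u)| ≤ 2T² = Var(p²) (Cauchy–Schwarz +
L²-contraction under (a)); (d) |K_N(x,y,u)| ≤ C e^{−cu} from the proved exponential convergence
(2.5) (pinnedChainSemigroup_ergodic; Gibbs = μ⋆ by (a) + uniqueness of the invariant measure,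
proved); (e) hence K_N(x,y,·) ∈ L¹(0,∞). [difficulty: M] [CuneoEckmannHairerReyBellet2018,
BonettoLebowitzReyBellet2000]
#9 KernelSymmetry (support) — EVEN-SECTOR RECIPROCITY K_N(x,y,u) = K_N(y,x,u) for all x, y, u ≥ 0:
the equilibrium Langevin dynamics is reversible up to momentum reversal Π (generalised detailed
balance μ_T(f·P_u g) = μ_T((g∘Π)·P_u(f∘Π)); KDN 'using detailed balance'), and p² is Π-even.
Provable but needs the kernel-level reversibility of the constructed semigroup (generator identity
L* = ΠLΠ in L²(μ_T) + identification, or pathwise time reversal of the stationary solution);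
measurePreserving_momentumReversal is in tree. Not used by the Assembly (which gets the sum rule
from the response side); used by KernelMaxPrincipleGlue. [difficulty: L] [KunduDharNarayan2009,
EckmannPilletReyBellet1999b, CuneoEckmannHairerReyBellet2018]
#9 ExitSumRule (support) — EXIT IDENTITY ('all injected energy leaves through one of the two
baths'): for parameters > 0, T > 0, N ≥ 1 and every site x: K_N(x,0,·), K_N(x,N−1,·) ∈ L¹ and
γ(∫_0^∞K_N(x,0,u)du + ∫_0^∞K_N(x,N−1,u)du) = T². Proof sketch: d/du ∫(p_x²−T)P_u(H) dμ_T =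
∫(p_x²−T)P_u(LH) dμ_T with LH = γ(T−p_0²) + γ(T−p²_{N−1}) (generator_hamiltonian, in tree),
integrate over (0,∞): Cov_T(p_x²,H) − lim_u Cov_T(p_x²(0),H(u)) = T² − 0 (Var(p_x²)/2 = T²; mixing
from the proved (2.5)). Needs Dynkin for the polynomial H (truncation + (3.4)). For N = 1 the two
bath sites coincide and the identity reads 2γ∫K_1(0,0) = T². Exact for the harmonic chain too
(transmission + reflection = 1). [difficulty: M] [BonettoLebowitzReyBellet2000,
KunduDharNarayan2009, CuneoEckmannHairerReyBellet2018]
#9 KernelMaxPrinciple (support) — COVARIANCE-LEVEL MAXIMUM PRINCIPLE (the form consumed by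
EscapeDeficit / ContactEchoWindows / TwoChannelDephasing): for parameters > 0, T > 0, N ≥ 1, bath
sites b ∈ {0, N−1} and every site y: 0 ≤ (γ/T²)∫_0^∞K_N(b,y,u)du ≤ 1 and (γ/T²)(∫K_N(0,y) +
∫K_N(N−1,y)) = 1. In words: the bath-to-site occupation kernel is sub-stochastic with the two baths
as complete exits; with y = the other bath it puts the end-to-end transmission E_N =
(γ/T²)∫K_N(0,N−1) (EscapeDeficit's escape deficit, ContactEchoWindows' η̄_N) in [0,1] with E_N +
(γ/T²)∫K_N(0,0) = 1. [difficulty: S] [BonettoLebowitzLukkarinenOlla2009, KunduDharNarayan2009,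
RiederLebowitzLieb1967]
#9 KernelMaxPrincipleGlue (support) — glue of the covariance-level principle: DEPKinIntegrated →
KernelSymmetry → ExitSumRule → KernelMaxPrinciple (swap the indices in the exit identity by symmetry
under the integral, divide by T², use the two signs). PROVED by the planner (GlueCheck2.lean,
theorem glue_holds, rc 0, axioms propext/Classical.choice/Quot.sound; ~30 lines) — a prover re-files
it in Theorems. [difficulty: provable-now] [KunduDharNarayan2009]
#9 GibbsKineticTemperature (support) — EQUIPARTITION for the Gibbs state of the pinned chain (ω₂ >
0, lam, β ≥ 0, any γ, T > 0, every N and site y): gibbsMeasure N T is a probability measure (in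
tree: pinnedChain_isProbabilityMeasure_gibbsMeasure), p_y² is integrable and ∫ p_y² dμ_T = T
(Gaussian momentum marginal: the density factorises as e^{−Σp²/2T}·e^{−Φ(q)/T};
integral_gibbsMeasure + Mathlib's Gaussian integrals). Used by the Assembly to evaluate the
(1,1)-directional derivative (shifting both baths) as exactly 1. [difficulty: provable-now]
[BonettoLebowitzReyBellet2000, CuneoEckmannHairerReyBellet2018]
#9 HarmonicDEP (support) — THE INTEGRABLE ANCHOR (calibration rung; card anchor (i)): for the pinned
HARMONIC chain pinnedChain ω₂ 0 0 γ (ω₂, γ, T > 0), every N, x, y and u ≥ 0: K_N(x,y,u) ≥ 0, and in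
fact K_N(x,y,u) = 2·(∫ p_x·P_u(p_y) dμ_T)² (Isserlis/Wick: for centred jointly Gaussian A = p_x(0),
B = p_y(u), Cov(A²,B²) = 2Cov(A,B)²). Route to a proof in tree: the harmonic solMap is affine in the
initial condition with deterministic coefficients plus an independent Gaussian noise term (linear
SDE; LinearLangevinGaussian*.lean, HarmonicChainCovariance.lean), the Gibbs state is Gaussian
(gaussMeasure), so (z, w) is jointly Gaussian under μ_T ⊗ P_u. Shows positivity is NOT an anharmonic
effect and coexists with ballistic transport (the sign lever is honest about
HarmonicChainBallisticFlux). [difficulty: M] [RiederLebowitzLieb1967, Nakazawa1970,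
BonettoLebowitzLukkarinen2004]
#9 BoundaryThermalisationMonotone (support) — CROSS-ROUTE COROLLARY typed with route EscapeDeficit's
own let-bound K, θ (their notation: K N u = boundary autocorrelation of p_0² − T, θ N t =
(γ/T²)∫_0^t K N): for parameters > 0, T > 0 and all N, 0 ≤ s ≤ t ⇒ θ_N(s) ≤ θ_N(t) — the boundary
thermalisation curve is nondecreasing, i.e. the escape deficit E_N = 1 − θ_N(∞) = inf_t (1 − θ_N(t))
and 'an absorbing far bath never makes the near boundary thermalise MORE … SIGNS'
(EscapeDeficit.DiffusiveCrossover's foreseen child) hold in the strongest form. Immediate from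
DEPKin on the diagonal x = y = 0 (+ continuity from KernelBasics for the interval integral).
[difficulty: S] [KunduDharNarayan2009, BonettoLebowitzReyBellet2000]
#9 NessUnique (support) — SHARED HYPOTHESIS (identical signature to stmt-AtomisticToContinuum-0741
of FourierGreenKubo / EscapeDeficit / LocalOhmRigidity …; dedup intended): uniqueness of the weak
steady state (IsSteadyState class) of pinnedChain for all N, T_L, T_R > 0 — the hypothesis under
which DirectionalResponse and NessMaxPrinciple are non-vacuous; existence is the PROVED fact
CuneoEckmannHairerReyBellet2018_pinnedChain_holds. [difficulty: L] [CuneoEckmannHairerReyBellet2018,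
Carmona2007]

TWO-LAYER PLAN. Foreseen glued splits once a crux moves (nothing filed now): DEPKin ⇐
PerturbativeDEP (first order in (lam,β) at every harmonic double zero, all N ≤ N₀, bounded times:
finite Gaussian sums over the harmonic propagator) → MalliavinCurvatureSplit (∂_{T_b}⟨p_y²(t)⟩ =
γE∫_0^t D²_{b,s}p_y(t)² ds = 2E[K_{yb}²] + 2E[p_y K^{(2)}_{yb}]: manifestly positive tangent
intensity plus signed flow-curvature term driven by U‴ = 6lam·q, V‴ = 6β·r; claim 'curvature ≥
−intensity') → DEPKin (k = 2); DEPKinIntegrated ⇐ DEPKin + KernelBasics (k = 1, trivial) or, if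
DEPKin dies at echo times, ⇐ a resolvent form ⟨p_x²−T,(−L)⁻¹(p_y²−T)⟩ ≥ 0 via log-concave
(Caffarelli/Kim–Milman) comparison with the harmonic resolvent; DirectionalResponse ⇐
GibbsKernelInvariance → EquilibriumLinearResponse (Hairer–Majda Assumptions 1–3 from CEHR (2.5)) →
DirectionalResponse (k = 2). Later targets on the same cruxes (not items now): the GLOBAL maximum
principle T_R ≤ ⟨p_y²⟩_NESS ≤ T_L at finite δT (needs DEP∫ at every NESS + response around NESS,
merged card N2) and the multi-thermostat M-matrix statement (needs a multi-thermostat generator, see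
Definition requests).

KILL CRITERIA. (a) ¬DEPKinIntegrated at some (N, x, y, T, parameters) — e.g. a certified negative
∫_0^∞Cov(p_0²(0),p_y²(u))du for the dimer or trimer — refutes the load-bearing crux and the target's
mechanism: close `refuted:DEPKinIntegrated` and record in the census which consuming routes
(EscapeDeficit signs, ContactEcho η̄ ∈ [0,1] as a probability, Fekete/kirchhoff M-matrix) lose their
sign input. (b) ¬DEPKin with DEPKinIntegrated surviving (negative echo-time excursions, positive
integral) kills only the pointwise kernel reading (Lever 1 of the card,
BoundaryThermalisationMonotone): drop DEPKin, keep the route on rank 3. (c) A refutation of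
DirectionalResponse's FORMULA (not mere non-existence of the derivative) means the
normalisation/bookkeeping is wrong — repair by restate. (d) NessMaxPrinciple proved elsewhere by a
non-sign method (e.g. entropy-production bounds) moots the rung but not DEPKin. (e) Refutation of
NessUnique makes the conditional statements vacuous — pivot to the covariance-level
KernelMaxPrinciple as target.

NOT DECOMPOSED YET. The engines (perturbative first-order sign at all harmonic zeros; second-order
Malliavin/tangent-flow curvature split; log-concave transport of the Gibbs state, Hess Φ ≥
min(ω₂,1)) are layer-2 children of DEPKin, deliberately unfiled (D-0019); the SITE-ENERGY version of
DEP (bond energies split symmetrically; its static neighbour value involves the FPU-β cross moments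
and is NOT automatic), the infinite-volume kernel DEP_∞ with the Einstein–Helfand/MSD reading of
Green–Kubo (needs InfiniteChainDynamics objects and belongs with FourierGreenKubo's cruxes; note the
card's claim 'finite speed + return-probability decay ⇒ MSD ≲ t' is FALSE as stated — mass ε_t at
±vt is compatible with both — so only the dictionary κ = variance growth rate survives), DEP at
non-equilibrium steady states (global max principle), multi-thermostat/probe configurations
(M-matrix, resistor-network reduction, BLLO self-consistent chain), T-dependence of nothing (all
statements are signs). GibbsKernelInvariance is folded into KernelBasics rather than filed alone.

CHEAPEST FALSIFIER. FIRST-ORDER SIGN TEST AT THE HARMONIC DOUBLE ZEROS (computer algebra / kit, an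
afternoon; no dynamics to simulate): for the closed or bathed harmonic chain with N = 2, 3, 4 let
a_{xy}(t) be the coefficient of p_x in p_y(t); at each zero t₀ of a_{xy} (K = 2T²a² vanishes to
second order there) the O(lam,β) correction of K_N(x,y,t₀) is C₁ = 2E[:p_x²: p⁰_y(t₀) p¹_y(t₀)] (the
measure term vanishes), p¹_y the first-order flow correction driven by −lam·q³, −β·(∇q)³ — a finite
Wick sum over the harmonic propagator. ONE negative C₁ (lam, β > 0) refutes DEPKin at small
anharmonicity in the window γ² ≪ lam·T ≪ 1 where damping cannot rescue the sign. Done by hand here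
for N = 1 only (U = q²/2 + lam q⁴/4, γ → 0): C₁((2k+1)π/2) = +3·lam·T³ at EVERY zero, no secular
growth — survives for hardening lam > 0, would FAIL for lam < 0. Second cheapest: equilibrium MD of
the dimer/trimer (lam = β = T = γ = 1), ∫_0^{20}Cov(p_0²(0),p_y²(u))du for all y; a robust negative
value kills DEPKinIntegrated.

NUMBERS. Static values: K_N(x,y,0) = 2T²·δ_{xy} (Gibbs momenta i.i.d. N(0,T)); short-time order of
the adjacent-site zero: K_N(x,x+1,t) = T²E[V″(r)²]t⁴/2 + O(β)·T²t⁴ + O(t⁶) (harmonic: T²t⁴/2). Sum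
rules: γΣ_b∫_0^∞K_N(x,b) = T² (all x, N); N = 1: (γ/T²)∫_0^∞K_1(0,0) = 1/2. Harmonic anchor: K =
2Cov(p_x,p_y(u))², transmission E_N → 2(1+γ²)c_∞/γ² … (RLL/Nakazawa closed forms in
HarmonicChainFlux.lean: c_∞ = γr/(2(1+γ²)), r the root in (0,1) of r² − (2+λ)r + 1 = 0, λ =
ω₂γ²/(1+γ²)). BLLO: max principle proved only for harmonic self-consistent chains
(BonettoLebowitzLukkarinen2004); open for N = 3 anharmonic (BonettoLebowitzLukkarinenOlla2009 §9).
Items at open: 14 (1 target, 3 cruxes, 9 support, 1 assembly).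

DEFINITION REQUESTS. None needed for the items (pinnedChain, OscillatorChain.transitionKernel,
OscillatorChain.gibbsMeasure, OscillatorChain.IsSteadyState, PhaseSpace all exist; every constant
`lean search --decl`-checked, Sketch.lean rc 0). Wanted later (not filed now, shared wish with the
network/probe cards): a multi-thermostat generator (thermostat set B ⊆ Fin N, couplings γ_b,
temperatures T_b) under Literature/MathematicalPhysics/KineticTheory, to state DEP∫ and the M-matrix
/ resistor-network reduction for arbitrary probe sets and the BLLO self-consistent chain. Bib:
entries Zhao2006 (doi:10.1103/physrevlett.96.140602) and LiuEtAl2014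
(doi:10.1103/physrevlett.112.040601) generated with `lit cite` (planner folder zhao.bib, liu.bib) —
`ledger bib add` was blocked by a CLI fault at filing; cited by DOI meanwhile.

Novelty: Searches (2026-08-15, this planner, on top of the card's refuter novelty audit of
2026-08-15T05:04:59Z which read arXiv:1103.2835 pp. 3–4, arXiv:0809.0953 pp. 3, 6 and graded the
card new-combination): `lit frontier AtomisticToContinuum --since 2020` (30 rows; relevant:
arXiv:2604.14056 'Specific heat of thermally driven chains' = Σ_b∂_{T_b}⟨H⟩, arXiv:2606.08839;
nothing on correlation signs), `lit bridges AtomisticToContinuum --cross any` (30 rows, none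
relevant), `lit search --hybrid` ×2 ('positivity of energy density time correlations anharmonic
chain heat spreading kernel nonnegative'; 'Green-Kubo formula for heat conduction in open systems
Kundu Dhar Narayan') — textbooks + arXiv:2310.13338 only, `lit search --source crossref`
('spatiotemporal correlation energy fluctuations heat diffusion one-dimensional nonlinear lattices':
15 rows, the heat-diffusion phenomenology doi:10.1103/physrevlett.96.140602,
doi:10.1103/physreve.99.062125, doi:10.1103/physreve.93.032130 — kernels plotted as densities, no
sign statement), `lit vsearch` ×2 (max-principle phrasing: only book:liebnd-statistical-mechanics
pp. 338–341 = RLL reprint), `lit galaxy search --star pdf --mode substring 'temperature profile lies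
between'` (1 irrelevant hit), `lit galaxy search --star all` ×2 (queue saturated this hour —
recorded, not retried), openalex/arxiv/s2 cascades rate-limited (HTTP 429) this hour; `lit read
arXiv:0809.4543` p. 3 (J_fp, the response identity) and `lit read arXiv:0809.0953` pp. 6, 18 (  [refs: 10.1103/physrevlett.96.140602, 10.1103/physreve.99.062125, 10.1103/physreve.93.032130, 10.1103/physrevlett.112.040601, 10.1063/1.1664600, 10.1007/s002200050102, 10.1007/bf01312211, 1103.2835, 0809.0953, 2604.14056, 2606.08839, 2310.13338, 0809.4543, doi:10.1103/physrevlett.96.140602, doi:10.1103/physreve.99.062125, doi:10.1103/physreve.93.032130, book:liebnd-statistical-mechanics, doi:10.1103/phys]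

Barriers (technique_class: correlation-sign; comparison-principle; positive-kernel): - technique_class: correlation-sign; comparison-principle; positive-kernel
- Literature.Barriers.AtomisticToContinuum.HarmonicChainBallisticFlux: EMBRACED, not evaded — DEPKin
HOLDS for the refuted harmonic member (HarmonicDEP, Isserlis), so no item of this route can imply
FouriersLaw and none claims to (rung route; the Assembly ends in NessMaxPrinciple, which is also
true for the harmonic chain, RLL); the sign is a lever for other routes' transport cruxes, never a
transport estimate.
- Literature.Barriers.AtomisticToContinuum.HasBoundedResponse: not addressed and not claimed — every
deliverable here is an O(1) bound (d ∈ [0,1], transmission ∈ [0,1], |θ_N| ≤ 1/2), uniform in N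
BECAUSE it is a sign statement; DirectionalResponse sits inside the barrier's
fixed-N-linear-response class by design (it is used only at fixed N).
- Literature.Barriers.AtomisticToContinuum.LowTemperatureWeakAnharmonicity: the foreseen
PerturbativeDEP child is a finite-order expansion at bounded times and fixed N and claims nothing
uniform in (lam,β) → 0 or N; DEPKin itself is non-perturbative (all lam, β, T > 0) and is TRUE at
the harmonic fixed point, so the conjugacy (lam,β,T) ~ (lamT, βT) costs nothing: a sign is
scale-free.
- Literature.Barriers.AtomisticToContinuum.Mazur1969_inequality: blind spot acknowledged — conserved
charges that feed ballistic transport are momentum-ODD; DEP lives in the even sector and is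
consistent with their presence (harmonic case); no evasion needed for a rung that cla

History (route lifecycle, newest last):
- 2026-08-15T13:41:50Z · CLOSED retired — not-a-thesis: assembly does not conclude the sub-problem Statement (operator:999:1257524)

sub-problem: FouriersLaw · status: closed(retired) · opened planner-plancard-AtomisticToContinuum-Fourier-745a3ff0-0 2026-08-15T11:44:30Z · rev 0 · ledger route-AtomisticToContinuum-DynamicalGriffiths
GENERATED by the gate from the ledger (D-0016/17). Provers cite these decls: `theorem foo : Summit.AtomisticToContinuum.FouriersLaw.Theses.DynamicalGriffiths.<Decl> := …` in Summits/AtomisticToContinuum/FouriersLaw/Theorems/<Name>.lean.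
-/

namespace Summit.AtomisticToContinuum.FouriersLaw.Theses.DynamicalGriffiths

open scoped BigOperators Topology Manifold Classical MeasureTheory ProbabilityTheory Matrix InnerProductSpace ComplexConjugate ContinuousMap
open Filter Set Function TopologicalSpace MeasureTheory

attribute [summit_statement] _root_.FouriersLaw

/-- item stmt-AtomisticToContinuum-6089 · target · rank 0 · closed · moot by None · by planner
why it might fail: Inherits DEPKinIntegrated (a bath could, in time-integral, cool some site: resonant energy exchange in short strongly anharmonic chains) and fixed-N response existence (DirectionalResponse); BLLO could not prove the N = 3 self-consistent analogue.
sources: BonettoLebowitzLukkarinenOlla2009, BonettoLebowitzLukkarinen2004, RiederLebowitzLieb1967, KunduDharNarayan2009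
[target] X_DG of § Thesis: for pinnedChain (all parameters > 0), ASSUMING uniqueness of weak steady
states (hypothesis inside the statement, = NessUnique), for every steady-state family μ, T > 0, N
and y : Fin N there are d_L, d_R ∈ [0,1] with (⟨p_y²⟩_{μ N (T+δ) T} − ⟨p_y²⟩_{μ N T T})/δ → d_L and
(⟨p_y²⟩_{μ N T (T+δ)} − ⟨p_y²⟩_{μ N T T})/δ → d_R as δ → 0, δ ≠ 0 (N = 0 vacuous; N = 1: d_L = d_R =
1/2 by the proved one-site Gibbs state). The first-order, two-bath form of 'local kinetic
temperatures lie between the bath temperatures'. -/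
@[route_item "route-AtomisticToContinuum-DynamicalGriffiths"]
def NessMaxPrinciple : Prop :=
  ∀ ω₂ lam β γ : ℝ, 0 < ω₂ → 0 < lam → 0 < β → 0 < γ → (∀ (N : ℕ) (T_L T_R : ℝ), 0 < T_L → 0 < T_R → ∀ μ ν : MeasureTheory.Measure (Literature.MathematicalPhysics.KineticTheory.HeatConduction.PhaseSpace N), (Literature.MathematicalPhysics.KineticTheory.HeatConduction.pinnedChain ω₂ lam β γ).IsSteadyState N T_L T_R μ → (Literature.MathematicalPhysics.KineticTheory.HeatConduction.pinnedChain ω₂ lam β γ).IsSteadyState N T_L T_R ν → μ = ν) → ∀ μ : (N : ℕ) → ℝ → ℝ → MeasureTheory.Measure (Literature.MathematicalPhysics.KineticTheory.HeatConduction.PhaseSpace N), (∀ (N : ℕ) (T_L T_R : ℝ), 0 < T_L → 0 < T_R → (Literature.MathematicalPhysics.KineticTheory.HeatConduction.pinnedChain ω₂ lam β γ).IsSteadyState N T_L T_R (μ N T_L T_R)) → ∀ T : ℝ, 0 < T → ∀ (N : ℕ) (y : Fin N), (∃ d : ℝ, 0 ≤ d ∧ d ≤ 1 ∧ Filter.Tendsto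 (fun δ : ℝ => ((∫ z, (z.2 y) ^ 2 ∂(μ N (T + δ) T)) - ∫ z, (z.2 y) ^ 2 ∂(μ N T T)) / δ) (nhdsWithin 0 {(0 : ℝ)}ᶜ) (nhds d)) ∧ (∃ d : ℝ, 0 ≤ d ∧ d ≤ 1 ∧ Filter.Tendsto (fun δ : ℝ => ((∫ z, (z.2 y) ^ 2 ∂(μ N T (T + δ))) - ∫ z, (z.2 y) ^ 2 ∂(μ N T T)) / δ) (nhdsWithin 0 {(0 : ℝ)}ᶜ) (nhds d))

/-- item stmt-AtomisticToContinuum-6090 · crux · rank 2 · closed · moot by None · by planner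
why it might fail: At lam=β=0 the kernel 2Cov(p_x,p_y(u))² has double zeros (quarter periods, echo times); the O(lam,β) flow correction decides the sign there — +3lamT³ at N=1 by hand, chains (FPU-β cross force) untested; at λT=O(1) and intermediate times no expansion controls it.
sources: doi:10.1103/physrevlett.96.140602, doi:10.1103/physrevlett.112.040601, doi:10.1007/s002200050102, doi:10.1063/1.1664600, RiederLebowitzLieb1967, AokiLukkarinenSpohn2006
[crux] DYNAMICAL GRIFFITHS INEQUALITY, kinetic version, pointwise in time (card item DEP_kin /
DEP_open): for all parameters > 0, T > 0, N, sites x y and u ≥ 0: K_N(x,y,u) = ∫ (p_x² − T)·P_u(p_y²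
− T) dμ_T ≥ 0 (constructed kernels, Gibbs state, both baths at T). Static values are harmless
(K_N(x,y,0) = 2T²δ_{xy}: momenta are i.i.d. Gaussian under any Gibbs state); at lam = β = 0 it is
Isserlis (HarmonicDEP); the content is u > 0, lam, β > 0, all N uniformly — the statement that makes
Zhao's 'heat-diffusion probability density' an honest sub-probability kernel and every bath-to-site
response a comparison. [difficulty: open-problem] -/
@[route_item "route-AtomisticToContinuum-DynamicalGriffiths"]
def DEPKin : Prop :=
  ∀ ω₂ lam β γ : ℝ, 0 < ω₂ → 0 < lam → 0 < β → 0 < γ → ∀ T : ℝ, 0 < T → ∀ N : ℕ, (let P := Literature.MathematicalPhysics.KineticTheory.HeatConduction.pinnedChain ω₂ lam β γ; let K : Fin N → Fin N → ℝ → ℝ := fun x y u => ∫ z, ((z.2 x) ^ 2 - T) * (∫ w, ((w.2 y) ^ 2 - T) ∂(P.transitionKernel N T T u.toNNReal z)) ∂(P.gibbsMeasure N T); ∀ (x y : Fin N) (u : ℝ), 0 ≤ u → 0 ≤ K x y u)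

/-- item stmt-AtomisticToContinuum-6091 · crux · rank 3 · closed · moot by None · by planner
why it might fail: Still a genuine off-diagonal sign claim: energy 'sloshing' between specific sites of a short, strongly anharmonic chain (N=2,3, lam·T ≫ 1) could make one time-integral negative; no monotone-coupling proof exists for oscillators (Herbst–Pitt needs cooperative drift).
sources: KunduDharNarayan2009, BonettoLebowitzLukkarinenOlla2009, RiederLebowitzLieb1967, doi:10.1007/bf01312211
[crux] the graded weaker form actually used by the Assembly (card: DEP∫ / DEP_kin∫; merged card
energetic-attractiveness (A)): for all parameters > 0, T > 0, N, x, y: u ↦ K_N(x,y,u) is integrable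
on (0,∞) and ∫_0^∞ K_N(x,y,u) du ≥ 0. By KDN this is ∂⟨p_y²⟩/∂T_x ≥ 0 whenever x is a bath site
('heating a bath never cools a site', to first order); only the diagonal x = y is automatic
(∫_0^∞⟨f,P_u f⟩ = ⟨f,(−L)⁻¹f⟩ ≥ 0 by accretivity). Follows from DEPKin + KernelBasics; filed
separately because it may survive a refutation of the pointwise sign (echo-time negativity with
positive integral). [deps: DEPKin] [difficulty: open-problem] -/
@[route_item "route-AtomisticToContinuum-DynamicalGriffiths"]
def DEPKinIntegrated : Prop :=
  ∀ ω₂ lam β γ : ℝ, 0 < ω₂ → 0 < lam → 0 < β → 0 < γ → ∀ T : ℝ, 0 < T → ∀ N : ℕ, (let P := Literature.MathematicalPhysics.KineticTheory.HeatConduction.pinnedChain ω₂ lam β γ; let K : Fin N → Fin N → ℝ → ℝ := fun x y u => ∫ z, ((z.2 x) ^ 2 - T) * (∫ w, ((w.2 y) ^ 2 - T) ∂(P.transitionKernel N T T u.toNNReal z)) ∂(P.gibbsMeasure N T); ∀ x y : Fin N, MeasureTheory.IntegrableOn (K x y) (Set.Ioi 0) ∧ 0 ≤ ∫ u in Set.Ioi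 (0 : ℝ), K x y u)

/-- item stmt-AtomisticToContinuum-6092 · crux · rank 4 · closed · moot by None · by planner
why it might fail: Fixed-N linear response at equilibrium is unproved for the Langevin pinned chain (Hairer–Majda SDE Thm 4.4 Assumption 5 fails; verify Assumptions 1–3 via CEHR (2.5)); weak steady states might be non-unique, making the conditional form vacuous rather than false.
sources: KunduDharNarayan2009, ReyBellet2003, HairerMajda2009, BonettoLebowitzReyBellet2000, CuneoEckmannHairerReyBellet2018, Carmona2007
[crux] KUNDU–DHAR–NARAYAN NOISE-AMPLITUDE RESPONSE at fixed N (card item NoiseAmplitudeResponse +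
SumRule in one): ASSUMING weak-NESS uniqueness, for every steady-state family μ, T > 0, N ≥ 1, site
y and direction (a,b) ∈ ℝ²: K_N(0,y,·), K_N(N−1,y,·) ∈ L¹(0,∞) and (⟨p_y²⟩_{μ N (T+aδ) (T+bδ)} −
⟨p_y²⟩_{μ N T T})/δ → a·(γ/T²)∫_0^∞K_N(0,y) + b·(γ/T²)∫_0^∞K_N(N−1,y) as δ → 0, δ ≠ 0. Derivation
(KDN, arXiv:0809.4543 p. 3): ∂_{T_L}L = γ∂²_{p_0}, (P₀)⁻¹γ∂²_{p_0}P₀ = γ(p_0² − T)/T², first-order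
perturbation of the Fokker–Planck equation from t = −∞; for N = 1 both baths sit on site 0 and the
formula gives (a+b)/2, matching the proved one-site Gibbs state at (T_L+T_R)/2. Real content:
differentiability at equilibrium of NESS expectations of p_y² in the bath temperatures for the
hypoelliptic chain (same difficulty class as items 0717 FiniteResponseOfUnique / 2945
ResponseIdentity / 2742 FiniteResponseProfile, different observable and both one-bath directions),
Gibbs invariance of the constructed kernels, K ∈ L¹ from the PROVED (2.5). [difficulty: L] -/
@[route_item "route-AtomisticToContinuum-DynamicalGriffiths"]
def DirectionalResponse : Prop :=
  ∀ ω₂ lam β γ : ℝ, 0 < ω₂ → 0 < lam → 0 < β → 0 < γ → (∀ (N : ℕ) (T_L T_R : ℝ), 0 < T_L → 0 < T_R → ∀ μ ν : MeasureTheory.Measure (Literature.MathematicalPhysics.KineticTheory.HeatConduction.PhaseSpace N), (Literature.MathematicalPhysics.KineticTheory.HeatConduction.pinnedChain ω₂ lam β γ).IsSteadyState N T_L T_R μ → (Literature.MathematicalPhysics.KineticTheory.HeatConduction.pinnedChain ω₂ lam β γ).IsSteadyState N T_L T_R ν → μ = ν) → ∀ μ : (N : ℕ) → ℝ → ℝ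 → MeasureTheory.Measure (Literature.MathematicalPhysics.KineticTheory.HeatConduction.PhaseSpace N), (∀ (N : ℕ) (T_L T_R : ℝ), 0 < T_L → 0 < T_R → (Literature.MathematicalPhysics.KineticTheory.HeatConduction.pinnedChain ω₂ lam β γ).IsSteadyState N T_L T_R (μ N T_L T_R)) → ∀ T : ℝ, 0 < T → ∀ (N : ℕ) (hN : 0 < N), (let P := Literature.MathematicalPhysics.KineticTheory.HeatConduction.pinnedChain ω₂ lam β γ; let K : Fin N → Fin N → ℝ → ℝ := fun x y u => ∫ z, ((z.2 x) ^ 2 - T) * (∫ w, ((w.2 y) ^ 2 - T) ∂(P.transitionKernel N T T u.toNNReal z)) ∂(P.gibbsMeasure N T); ∀ (y : Fin N) (a b : ℝ), MeasureTheory.IntegrableOn (K ⟨0, hN⟩ y) (Set.Ioi 0) ∧ MeasureTheory.IntegrableOn (K ⟨N - 1, by omega⟩ y) (Set.Ioi 0) ∧ Filter.Tendsto (fun δ : ℝ => ((∫ z, (z.2 y) ^ 2 ∂(μ N (T + a * δ) (T + b * δ))) - ∫ z, (z.2 y) ^ 2 ∂(μ N T T)) / δ) (nhdsWithin 0 {(0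 : ℝ)}ᶜ) (nhds (a * (γ / T ^ 2 * ∫ u in Set.Ioi (0 : ℝ), K ⟨0, hN⟩ y u) + b * (γ / T ^ 2 * ∫ u in Set.Ioi (0 : ℝ), K ⟨N - 1, by omega⟩ y u))))

/-- item stmt-AtomisticToContinuum-6093 · support · rank 9 · closed · moot by None · by planner
sources: CuneoEckmannHairerReyBellet2018, BonettoLebowitzReyBellet2000
[support] warm-up that de-junks K (cf. EscapeDeficit.BoundaryKernelBasics, same content for general
x, y): for parameters > 0, T > 0, N ≥ 1: (a) Gibbs invariance of the constructed kernels,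
(gibbsMeasure N T).bind (transitionKernel N T T t) = gibbsMeasure N T (weak stationarity
pinnedChain_isSteadyState_gibbsMeasure is proved; invariance for the kernels needs Dynkin +
uniqueness for the forward equation, or Itô on solMap); (b) u ↦ K_N(x,y,u) continuous (Feller,
proved, + dominated convergence via (3.4)); (c) |K_N(x,y,u)| ≤ 2T² = Var(p²) (Cauchy–Schwarz +
L²-contraction under (a)); (d) |K_N(x,y,u)| ≤ C e^{−cu} from the proved exponential convergence
(2.5) (pinnedChainSemigroup_ergodic; Gibbs = μ⋆ by (a) + uniqueness of the invariant measure,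
proved); (e) hence K_N(x,y,·) ∈ L¹(0,∞). [difficulty: M] -/
@[route_item "route-AtomisticToContinuum-DynamicalGriffiths"]
def KernelBasics : Prop :=
  ∀ ω₂ lam β γ : ℝ, 0 < ω₂ → 0 < lam → 0 < β → 0 < γ → ∀ T : ℝ, 0 < T → ∀ N : ℕ, 0 < N → (let P := Literature.MathematicalPhysics.KineticTheory.HeatConduction.pinnedChain ω₂ lam β γ; let K : Fin N → Fin N → ℝ → ℝ := fun x y u => ∫ z, ((z.2 x) ^ 2 - T) * (∫ w, ((w.2 y) ^ 2 - T) ∂(P.transitionKernel N T T u.toNNReal z)) ∂(P.gibbsMeasure N T); (∀ t : NNReal, (P.gibbsMeasure N T).bind (P.transitionKernel N T T t) = P.gibbsMeasure N T) ∧ (∀ x y : Fin N, Continuous (K x y)) ∧ (∀ (x y : Fin N) (u : ℝ), |K x y u| ≤ 2 * T ^ 2) ∧ (∀ x y : Fin N, ∃ C c : ℝ, 0 < c ∧ ∀ u : ℝ, 0 ≤ u → |K x y u| ≤ C * Real.exp (-c * u)) ∧ (∀ x y : Fin N, MeasureTheory.IntegrableOn (K x y) (Set.Ioi 0)))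

/-- item stmt-AtomisticToContinuum-6094 · support · rank 9 · closed · moot by None · by planner
sources: KunduDharNarayan2009, EckmannPilletReyBellet1999b, CuneoEckmannHairerReyBellet2018
[support] EVEN-SECTOR RECIPROCITY K_N(x,y,u) = K_N(y,x,u) for all x, y, u ≥ 0: the equilibrium
Langevin dynamics is reversible up to momentum reversal Π (generalised detailed balance μ_T(f·P_u g)
= μ_T((g∘Π)·P_u(f∘Π)); KDN 'using detailed balance'), and p² is Π-even. Provable but needs the
kernel-level reversibility of the constructed semigroup (generator identity L* = ΠLΠ in L²(μ_T) +
identification, or pathwise time reversal of the stationary solution);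
measurePreserving_momentumReversal is in tree. Not used by the Assembly (which gets the sum rule
from the response side); used by KernelMaxPrincipleGlue. [difficulty: L] -/
@[route_item "route-AtomisticToContinuum-DynamicalGriffiths"]
def KernelSymmetry : Prop :=
  ∀ ω₂ lam β γ : ℝ, 0 < ω₂ → 0 < lam → 0 < β → 0 < γ → ∀ T : ℝ, 0 < T → ∀ N : ℕ, (let P := Literature.MathematicalPhysics.KineticTheory.HeatConduction.pinnedChain ω₂ lam β γ; let K : Fin N → Fin N → ℝ → ℝ := fun x y u => ∫ z, ((z.2 x) ^ 2 - T) * (∫ w, ((w.2 y) ^ 2 - T) ∂(P.transitionKernel N T T u.toNNReal z)) ∂(P.gibbsMeasure N T); ∀ (x y : Fin N) (u : ℝ), 0 ≤ u → K x y u = K y x u)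

/-- item stmt-AtomisticToContinuum-6095 · support · rank 9 · closed · moot by None · by planner
sources: BonettoLebowitzReyBellet2000, KunduDharNarayan2009, CuneoEckmannHairerReyBellet2018
[support] EXIT IDENTITY ('all injected energy leaves through one of the two baths'): for parameters
> 0, T > 0, N ≥ 1 and every site x: K_N(x,0,·), K_N(x,N−1,·) ∈ L¹ and γ(∫_0^∞K_N(x,0,u)du +
∫_0^∞K_N(x,N−1,u)du) = T². Proof sketch: d/du ∫(p_x²−T)P_u(H) dμ_T = ∫(p_x²−T)P_u(LH) dμ_T with LH =
γ(T−p_0²) + γ(T−p²_{N−1}) (generator_hamiltonian, in tree), integrate over (0,∞): Cov_T(p_x²,H) −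
lim_u Cov_T(p_x²(0),H(u)) = T² − 0 (Var(p_x²)/2 = T²; mixing from the proved (2.5)). Needs Dynkin
for the polynomial H (truncation + (3.4)). For N = 1 the two bath sites coincide and the identity
reads 2γ∫K_1(0,0) = T². Exact for the harmonic chain too (transmission + reflection = 1).
[difficulty: M] -/
@[route_item "route-AtomisticToContinuum-DynamicalGriffiths"]
def ExitSumRule : Prop :=
  ∀ ω₂ lam β γ : ℝ, 0 < ω₂ → 0 < lam → 0 < β → 0 < γ → ∀ T : ℝ, 0 < T → ∀ (N : ℕ) (hN : 0 < N), (let P := Literature.MathematicalPhysics.KineticTheory.HeatConduction.pinnedChain ω₂ lam β γ; let K : Fin N → Fin N → ℝ → ℝ := fun x y u => ∫ z, ((z.2 x) ^ 2 - T) * (∫ w, ((w.2 y) ^ 2 - T) ∂(P.transitionKernel N T T u.toNNReal z)) ∂(P.gibbsMeasure N T); ∀ x : Fin N, MeasureTheory.IntegrableOn (K x ⟨0, hN⟩) (Set.Ioi 0) ∧ MeasureTheory.IntegrableOn (K x ⟨N - 1, by omega⟩) (Set.Ioi 0) ∧ γ * ((∫ u in Set.Ioi (0 : ℝ), K x ⟨0,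 hN⟩ u) + ∫ u in Set.Ioi (0 : ℝ), K x ⟨N - 1, by omega⟩ u) = T ^ 2)

/-- item stmt-AtomisticToContinuum-6096 · support · rank 9 · closed · moot by None · by planner
sources: BonettoLebowitzLukkarinenOlla2009, KunduDharNarayan2009, RiederLebowitzLieb1967
[support] COVARIANCE-LEVEL MAXIMUM PRINCIPLE (the form consumed by EscapeDeficit /
ContactEchoWindows / TwoChannelDephasing): for parameters > 0, T > 0, N ≥ 1, bath sites b ∈ {0, N−1}
and every site y: 0 ≤ (γ/T²)∫_0^∞K_N(b,y,u)du ≤ 1 and (γ/T²)(∫K_N(0,y) + ∫K_N(N−1,y)) = 1. In words: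
the bath-to-site occupation kernel is sub-stochastic with the two baths as complete exits; with y =
the other bath it puts the end-to-end transmission E_N = (γ/T²)∫K_N(0,N−1) (EscapeDeficit's escape
deficit, ContactEchoWindows' η̄_N) in [0,1] with E_N + (γ/T²)∫K_N(0,0) = 1. [difficulty: S] -/
@[route_item "route-AtomisticToContinuum-DynamicalGriffiths"]
def KernelMaxPrinciple : Prop :=
  ∀ ω₂ lam β γ : ℝ, 0 < ω₂ → 0 < lam → 0 < β → 0 < γ → ∀ T : ℝ, 0 < T → ∀ (N : ℕ) (hN : 0 < N), (let P := Literature.MathematicalPhysics.KineticTheory.HeatConduction.pinnedChain ω₂ lam β γ; let K : Fin N → Fin N → ℝ → ℝ := fun x y u => ∫ z, ((z.2 x) ^ 2 - T) * (∫ w, ((w.2 y) ^ 2 - T) ∂(P.transitionKernel N T T u.toNNReal z)) ∂(P.gibbsMeasure N T); ∀ y : Fin N, 0 ≤ γ / T ^ 2 * ∫ u in Set.Ioi (0 : ℝ), K ⟨0, hN⟩ y u ∧ γ / T ^ 2 * ∫ u in Set.Ioi (0 : ℝ), K ⟨0, hN⟩ y u ≤ 1 ∧ 0 ≤ γ / T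 ^ 2 * ∫ u in Set.Ioi (0 : ℝ), K ⟨N - 1, by omega⟩ y u ∧ γ / T ^ 2 * ∫ u in Set.Ioi (0 : ℝ), K ⟨N - 1, by omega⟩ y u ≤ 1 ∧ γ / T ^ 2 * ((∫ u in Set.Ioi (0 : ℝ), K ⟨0, hN⟩ y u) + ∫ u in Set.Ioi (0 : ℝ), K ⟨N - 1, by omega⟩ y u) = 1)

/-- item stmt-AtomisticToContinuum-6097 · support · rank 9 · closed · moot by None · by planner
sources: KunduDharNarayan2009
[support] glue of the covariance-level principle: DEPKinIntegrated → KernelSymmetry → ExitSumRule →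
KernelMaxPrinciple (swap the indices in the exit identity by symmetry under the integral, divide by
T², use the two signs). PROVED by the planner (GlueCheck2.lean, theorem glue_holds, rc 0, axioms
propext/Classical.choice/Quot.sound; ~30 lines) — a prover re-files it in Theorems. [difficulty:
provable-now] -/
@[route_item "route-AtomisticToContinuum-DynamicalGriffiths"]
def KernelMaxPrincipleGlue : Prop :=
  DEPKinIntegrated → KernelSymmetry → ExitSumRule → KernelMaxPrinciple

/-- item stmt-AtomisticToContinuum-6098 · support · rank 9 · closed · moot by None · by planner
sources: BonettoLebowitzReyBellet2000, CuneoEckmannHairerReyBellet2018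
[support] EQUIPARTITION for the Gibbs state of the pinned chain (ω₂ > 0, lam, β ≥ 0, any γ, T > 0,
every N and site y): gibbsMeasure N T is a probability measure (in tree:
pinnedChain_isProbabilityMeasure_gibbsMeasure), p_y² is integrable and ∫ p_y² dμ_T = T (Gaussian
momentum marginal: the density factorises as e^{−Σp²/2T}·e^{−Φ(q)/T}; integral_gibbsMeasure +
Mathlib's Gaussian integrals). Used by the Assembly to evaluate the (1,1)-directional derivative
(shifting both baths) as exactly 1. [difficulty: provable-now] -/
@[route_item "route-AtomisticToContinuum-DynamicalGriffiths"]
def GibbsKineticTemperature : Prop :=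
  ∀ ω₂ lam β γ : ℝ, 0 < ω₂ → 0 ≤ lam → 0 ≤ β → ∀ T : ℝ, 0 < T → ∀ (N : ℕ) (y : Fin N), MeasureTheory.IsProbabilityMeasure ((Literature.MathematicalPhysics.KineticTheory.HeatConduction.pinnedChain ω₂ lam β γ).gibbsMeasure N T) ∧ MeasureTheory.Integrable (fun z : Literature.MathematicalPhysics.KineticTheory.HeatConduction.PhaseSpace N => (z.2 y) ^ 2) ((Literature.MathematicalPhysics.KineticTheory.HeatConduction.pinnedChain ω₂ lam β γ).gibbsMeasure N T) ∧ ∫ z, (z.2 y) ^ 2 ∂((Literature.MathematicalPhysics.KineticTheory.HeatConduction.pinnedChain ω₂ lam β γ).gibbsMeasure N T) = T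

/-- item stmt-AtomisticToContinuum-6099 · support · rank 9 · closed · moot by None · by planner
sources: RiederLebowitzLieb1967, Nakazawa1970, BonettoLebowitzLukkarinen2004
[support] THE INTEGRABLE ANCHOR (calibration rung; card anchor (i)): for the pinned HARMONIC chain
pinnedChain ω₂ 0 0 γ (ω₂, γ, T > 0), every N, x, y and u ≥ 0: K_N(x,y,u) ≥ 0, and in fact K_N(x,y,u)
= 2·(∫ p_x·P_u(p_y) dμ_T)² (Isserlis/Wick: for centred jointly Gaussian A = p_x(0), B = p_y(u),
Cov(A²,B²) = 2Cov(A,B)²). Route to a proof in tree: the harmonic solMap is affine in the initial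
condition with deterministic coefficients plus an independent Gaussian noise term (linear SDE;
LinearLangevinGaussian*.lean, HarmonicChainCovariance.lean), the Gibbs state is Gaussian
(gaussMeasure), so (z, w) is jointly Gaussian under μ_T ⊗ P_u. Shows positivity is NOT an anharmonic
effect and coexists with ballistic transport (the sign lever is honest about
HarmonicChainBallisticFlux). [difficulty: M] -/
@[route_item "route-AtomisticToContinuum-DynamicalGriffiths"]
def HarmonicDEP : Prop :=
  ∀ ω₂ γ T : ℝ, 0 < ω₂ → 0 < γ → 0 < T → ∀ (N : ℕ) (x y : Fin N) (u : NNReal), 0 ≤ ∫ z, ((z.2 x) ^ 2 - T) * (∫ w, ((w.2 y) ^ 2 - T) ∂((Literature.MathematicalPhysics.KineticTheory.HeatConduction.pinnedChain ω₂ 0 0 γ).transitionKernel N T T u z)) ∂((Literature.MathematicalPhysics.KineticTheory.HeatConduction.pinnedChain ω₂ 0 0 γ).gibbsMeasure N T) ∧ ∫ z, ((z.2 x) ^ 2 - T) * (∫ w, ((w.2 y) ^ 2 - T) ∂((Literature.MathematicalPhysics.KineticTheory.HeatConduction.pinnedChain ω₂ 0 0 γ).transitionKernel N T T u z)) ∂((Literature.MathematicalPhysics.KineticTheory.HeatConduction.pinnedChain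 ω₂ 0 0 γ).gibbsMeasure N T) = 2 * (∫ z, z.2 x * (∫ w, w.2 y ∂((Literature.MathematicalPhysics.KineticTheory.HeatConduction.pinnedChain ω₂ 0 0 γ).transitionKernel N T T u z)) ∂((Literature.MathematicalPhysics.KineticTheory.HeatConduction.pinnedChain ω₂ 0 0 γ).gibbsMeasure N T)) ^ 2

/-- item stmt-AtomisticToContinuum-6100 · support · rank 9 · closed · moot by None · by planner
sources: KunduDharNarayan2009, BonettoLebowitzReyBellet2000
[support] CROSS-ROUTE COROLLARY typed with route EscapeDeficit's own let-bound K, θ (their notation: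
K N u = boundary autocorrelation of p_0² − T, θ N t = (γ/T²)∫_0^t K N): for parameters > 0, T > 0
and all N, 0 ≤ s ≤ t ⇒ θ_N(s) ≤ θ_N(t) — the boundary thermalisation curve is nondecreasing, i.e.
the escape deficit E_N = 1 − θ_N(∞) = inf_t (1 − θ_N(t)) and 'an absorbing far bath never makes the
near boundary thermalise MORE … SIGNS' (EscapeDeficit.DiffusiveCrossover's foreseen child) hold in
the strongest form. Immediate from DEPKin on the diagonal x = y = 0 (+ continuity from KernelBasics
for the interval integral). [difficulty: S] -/
@[route_item "route-AtomisticToContinuum-DynamicalGriffiths"]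
def BoundaryThermalisationMonotone : Prop :=
  ∀ ω₂ lam β γ : ℝ, 0 < ω₂ → 0 < lam → 0 < β → 0 < γ → ∀ T : ℝ, 0 < T → (let P := Literature.MathematicalPhysics.KineticTheory.HeatConduction.pinnedChain ω₂ lam β γ; let K : ℕ → ℝ → ℝ := fun N u => if h : 0 < N then ∫ z, ((z.2 ⟨0, h⟩) ^ 2 - T) * (∫ y, ((y.2 ⟨0, h⟩) ^ 2 - T) ∂(P.transitionKernel N T T u.toNNReal z)) ∂(P.gibbsMeasure N T) else 0; let θ : ℕ → ℝ → ℝ := fun N t => γ / T ^ 2 * ∫ u in (0 : ℝ)..t, K N u; ∀ (N : ℕ) (s t : ℝ), 0 ≤ s → s ≤ t → θ N s ≤ θ N t)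

/-- item stmt-AtomisticToContinuum-6101 · assembly · rank 1 · closed · moot by None · by planner
sources: KunduDharNarayan2009, BonettoLebowitzLukkarinenOlla2009
[assembly] DEPKinIntegrated → DirectionalResponse → GibbsKineticTemperature → NessMaxPrinciple (the
rung target; planner-proved glue). -/
@[route_item "route-AtomisticToContinuum-DynamicalGriffiths"]
def Assembly : Prop :=
  DEPKinIntegrated → DirectionalResponse → GibbsKineticTemperature → NessMaxPrinciple

end Summit.AtomisticToContinuum.FouriersLaw.Theses.DynamicalGriffiths
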